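import Literature.AlgebraicGeometry.Deformation.SmoothSchemeLiftObstructionCriterionGlueCharts
import HarnessLib

/-!
# Gluing the lifted charts, II: the transition maps `Spec (Λ ∘ ψ⁻¹ ∘ Φ)`
# (Hartshorne, *Deformation Theory*, proof of Thm. 10.2 (a): «we can glue the schemes `U'_i` along these isomorphisms»)

HOME SEED (cell `hodgecm-mathlib`, F-11 (A3) F3b FILE 1b; provisional path
`Deformation/SmoothSchemeLiftObstructionCriterionGlueTransition.lean`).  Theorems only; imports FILE 1a.

For two charts `Spec (R ⊗_k Γ(V₀))`, `Spec (R ⊗_k Γ(V₁))` (projections `p₀, p₁`, characterised), an open `W` of the first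
chart over `V₀ ∩ V₁`, its chart ring map `Λ : R ⊗_k Γ(V₀ ∩ V₁) → Γ(W)`, the base change `Φ₁ : R ⊗_k Γ(V₁) → R ⊗_k Γ(V₀ ∩ V₁)`
and an `R`-automorphism `ψ` of `R ⊗_k Γ(V₀ ∩ V₁)` (a lifted transition automorphism), the TRANSITION MAP is
`t = W.toSpecΓ ≫ Spec (Λ ∘ ψ⁻¹ ∘ Φ₁) : W → Spec (R ⊗_k Γ(V₁))`.  THIS FILE proves:

* §F `chart_transition_base` / `_apply` — if `ψ` moves every element by a NILPOTENT, `t ≫ p₁` has the same underlying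
  continuous map as `W ↪ Spec (R ⊗_k Γ(V₀)) → X` (the underlying space does not change; `Spec ψ` is the identity on
  points) — the input for the axioms `t_mem`/`dom` of ★ `Morphisms/GlueDataOfOpens.OpensGlueDatum`;
* §G sections of a morphism in normal form through an affine open (`appLE_toSpecΓ_SpecMap_fromSpec`); automorphisms and
  base changes fix `r ⊗ 1`;
* §H `transition_self` — for `ψ = 1` the transition is the inclusion (axiom `t_self`); base-change maps along equal
  opens are injective (used in FILE 1c to read `ψ j j = 1` off the cocycle condition).

HC_CM is proved only modulo the 7 printed citations until rung 0 closes — nothing here bears on a summit statement.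

## References
* [Hartshorne2010] R. Hartshorne, *Deformation Theory*, GTM 257, Springer (2010): Thm. 10.2 (a) and its proof (p. 81).
* [Hartshorne1977] R. Hartshorne, *Algebraic Geometry*, GTM 52 (1977): II Prop. 2.3 / Ex. 2.4, II Ex. 2.12.
* [StacksProject] The Stacks Project, Tag 01JA (glueing schemes).
-/

noncomputable section

-- `TopCat.Presheaf`/`TopCat.Sheaf` are not reducible (as in Mathlib's `AlgebraicGeometry/Modules`).
set_option backward.isDefEq.respectTransparency false

open CategoryTheory AlgebraicGeometry Opposite TopologicalSpace
open scoped TensorProduct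

universe u

namespace Literature.AlgebraicGeometry.Deformation

open Literature.AlgebraicGeometry.Motives

/-! ## §F The transition maps: same underlying map as the trivial re-gluing; the self-transition -/

section Transition

variable {k : Type u} [Field k] {X : Over (Spec (CommRingCat.of k))}
  [instΓ : ∀ W : X.left.Opens, Algebra k Γ(X.left, W)]
  (halg : ∀ (W : X.left.Opens) (s : k), algebraMap k Γ(X.left, W) s = (constToPresheaf X).app (op W) s)
  {R : Type u} [CommRing R] [Algebra k R]
  {V₀ V₁ : X.left.Opens} (hV₀ : IsAffineOpen V₀) (hV₁ : IsAffineOpen V₁) (h01 : IsAffineOpen (V₀ ⊓ V₁))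
  (p₀ : Spec (CommRingCat.of (R ⊗[k] Γ(X.left, V₀))) ⟶ X.left)
  (hp₀ : p₀ = Spec.map (CommRingCat.ofHom
    (Algebra.TensorProduct.includeRight (R := k) (A := R) (B := Γ(X.left, V₀))).toRingHom) ≫ hV₀.fromSpec)
  (p₁ : Spec (CommRingCat.of (R ⊗[k] Γ(X.left, V₁))) ⟶ X.left)
  (hp₁ : p₁ = Spec.map (CommRingCat.ofHom
    (Algebra.TensorProduct.includeRight (R := k) (A := R) (B := Γ(X.left, V₁))).toRingHom) ≫ hV₁.fromSpec)

include hp₁ in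
/-- `Spec` of a ring map out of `Γ(V₀ ∩ V₁)` followed by the chart projection of `V₁` factors through `V₀ ∩ V₁ ↪ X`.
[cite: Hartshorne1977, II Prop. 2.3 / Ex. 2.4 (morphisms to `Spec`)] -/
theorem toSpecΓ_SpecMap_comp_chart {Y : Scheme.{u}} (g : R ⊗[k] Γ(X.left, V₀ ⊓ V₁) →+* Γ(Y, ⊤))
    {Φ₁ : R ⊗[k] Γ(X.left, V₁) →ₐ[R] R ⊗[k] Γ(X.left, V₀ ⊓ V₁)}
    (hΦ₁ : ∀ a s, Φ₁ (a ⊗ₜ s) = a ⊗ₜ X.left.presheaf.map (homOfLE inf_le_right).op s) :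
    (Y.toSpecΓ ≫ Spec.map (CommRingCat.ofHom (g.comp Φ₁.toRingHom))) ≫ p₁ =
      Y.toSpecΓ ≫ Spec.map (CommRingCat.ofHom (g.comp
        (Algebra.TensorProduct.includeRight (R := k) (A := R) (B := Γ(X.left, V₀ ⊓ V₁))).toRingHom)) ≫
        h01.fromSpec := by
  subst hp₁
  have e : CommRingCat.ofHom (Algebra.TensorProduct.includeRight (R := k) (A := R) (B := Γ(X.left, V₁))).toRingHom ≫
      CommRingCat.ofHom (g.comp Φ₁.toRingHom) =
      X.left.presheaf.map (homOfLE (inf_le_right : V₀ ⊓ V₁ ≤ V₁)).op ≫ CommRingCat.ofHom (g.comp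
        (Algebra.TensorProduct.includeRight (R := k) (A := R) (B := Γ(X.left, V₀ ⊓ V₁))).toRingHom) := by
    apply CommRingCat.hom_ext
    refine RingHom.ext fun c => ?_
    exact congrArg g (hΦ₁ 1 c)
  simp only [Category.assoc]
  rw [← Spec.map_comp_assoc, e, Spec.map_comp_assoc, hV₁.map_fromSpec h01]

include hp₀ in
/-- The inclusion of an open `W` of the chart of `V₀` lying over `V₀ ∩ V₁`, followed by the chart projection, in
normal form through `V₀ ∩ V₁ ↪ X`. [cite: Hartshorne1977, II Prop. 2.3 / Ex. 2.4 (morphisms to `Spec`)] -/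
theorem ι_comp_chart {W : (Spec (CommRingCat.of (R ⊗[k] Γ(X.left, V₀)))).Opens} (hW : ⊤ ≤ (W.ι ≫ p₀) ⁻¹ᵁ (V₀ ⊓ V₁))
    {Λ : R ⊗[k] Γ(X.left, V₀ ⊓ V₁) →+* Γ(↑W, ⊤)}
    (h₂ : ∀ c : Γ(X.left, V₀ ⊓ V₁), Λ (1 ⊗ₜ c) = (W.ι ≫ p₀).appLE (V₀ ⊓ V₁) ⊤ hW c) :
    W.ι ≫ p₀ = (W : Scheme.{u}).toSpecΓ ≫ Spec.map (CommRingCat.ofHom (Λ.comp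
        (Algebra.TensorProduct.includeRight (R := k) (A := R) (B := Γ(X.left, V₀ ⊓ V₁))).toRingHom)) ≫
        h01.fromSpec := by
  have e : CommRingCat.ofHom (Algebra.TensorProduct.includeRight (R := k) (A := R) (B := Γ(X.left, V₀))).toRingHom ≫
      (Scheme.ΓSpecIso (CommRingCat.of (R ⊗[k] Γ(X.left, V₀)))).inv ≫ W.ι.appTop =
      X.left.presheaf.map (homOfLE (inf_le_left : V₀ ⊓ V₁ ≤ V₀)).op ≫ CommRingCat.ofHom (Λ.comp
        (Algebra.TensorProduct.includeRight (R := k) (A := R) (B := Γ(X.left, V₀ ⊓ V₁))).toRingHom) := by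
    apply CommRingCat.hom_ext
    refine RingHom.ext fun c => ?_
    exact (chartRingHom_one_tmul_map hV₀ p₀ hp₀ inf_le_left h₂ c).symm
  conv_lhs => rw [eq_toSpecΓ_SpecMap W.ι, hp₀]
  rw [Category.assoc, ← Spec.map_comp_assoc, e, Spec.map_comp_assoc, hV₀.map_fromSpec h01]

/-- `Spec` of a ring automorphism moving every element by a nilpotent is the identity on the underlying space.
[cite: Hartshorne2010, Thm. 10.2 (proof), p. 81] -/
theorem SpecMap_base_eq_id_of_sub_isNilpotent {S : Type u} [CommRing S] (u : S →+* S)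
    (hu : ∀ x, IsNilpotent (u x - x)) : (Spec.map (CommRingCat.ofHom u)).base = 𝟙 _ := by
  apply TopCat.ext
  intro y
  change Spec.map (CommRingCat.ofHom u) y = y
  rw [Spec.map_apply]
  exact comap_eq_self_of_sub_isNilpotent u hu y

include hp₀ hp₁ h01 in
/-- **The transition map has the same underlying map as the trivial re-gluing**: for an `R`-automorphism `ψ` of
`R ⊗_k Γ(V₀ ∩ V₁)` moving every element by a NILPOTENT, the transition
`t = W.toSpecΓ ≫ Spec (Λ ∘ ψ⁻¹ ∘ Φ₁) : W → Spec (R ⊗_k Γ(V₁))` followed by the chart projection `p₁` has the same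
underlying continuous map as `W ↪ Spec (R ⊗_k Γ(V₀)) → X` (`Spec ψ` is the identity on points).
[cite: Hartshorne2010, Thm. 10.2 (proof), p. 81] -/
theorem chart_transition_base {W : (Spec (CommRingCat.of (R ⊗[k] Γ(X.left, V₀)))).Opens}
    (hW : ⊤ ≤ (W.ι ≫ p₀) ⁻¹ᵁ (V₀ ⊓ V₁))
    {Λ : R ⊗[k] Γ(X.left, V₀ ⊓ V₁) →+* Γ(↑W, ⊤)}
    (h₂ : ∀ c : Γ(X.left, V₀ ⊓ V₁), Λ (1 ⊗ₜ c) = (W.ι ≫ p₀).appLE (V₀ ⊓ V₁) ⊤ hW c)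
    (ψ : R ⊗[k] Γ(X.left, V₀ ⊓ V₁) ≃ₐ[R] R ⊗[k] Γ(X.left, V₀ ⊓ V₁)) (hψ : ∀ x, IsNilpotent (ψ x - x))
    {Φ₁ : R ⊗[k] Γ(X.left, V₁) →ₐ[R] R ⊗[k] Γ(X.left, V₀ ⊓ V₁)}
    (hΦ₁ : ∀ a s, Φ₁ (a ⊗ₜ s) = a ⊗ₜ X.left.presheaf.map (homOfLE inf_le_right).op s) :
    (((W : Scheme.{u}).toSpecΓ ≫ Spec.map (CommRingCat.ofHom
      (Λ.comp (ψ.symm.toAlgHom.toRingHom.comp Φ₁.toRingHom)))) ≫ p₁).base = (W.ι ≫ p₀).base := by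
  have hψ' : ∀ y, IsNilpotent (ψ.symm.toAlgHom.toRingHom y - y) := fun y => by
    have h := hψ (ψ.symm y)
    rw [AlgEquiv.apply_symm_apply] at h
    rw [← neg_sub]
    exact h.neg
  rw [← RingHom.comp_assoc, toSpecΓ_SpecMap_comp_chart hV₁ h01 p₁ hp₁ _ hΦ₁, ι_comp_chart hV₀ h01 p₀ hp₀ hW h₂,
    RingHom.comp_assoc]
  simp only [CommRingCat.ofHom_comp, Spec.map_comp, Scheme.Hom.comp_base, Category.assoc]
  rw [SpecMap_base_eq_id_of_sub_isNilpotent _ hψ', Category.id_comp]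

include hp₀ hp₁ h01 in
/-- Pointwise form of `chart_transition_base`: `p₁ (t x) = p₀ x` for every point `x ∈ W`.
[cite: Hartshorne2010, Thm. 10.2 (proof), p. 81] -/
theorem chart_transition_apply {W : (Spec (CommRingCat.of (R ⊗[k] Γ(X.left, V₀)))).Opens}
    (hW : ⊤ ≤ (W.ι ≫ p₀) ⁻¹ᵁ (V₀ ⊓ V₁))
    {Λ : R ⊗[k] Γ(X.left, V₀ ⊓ V₁) →+* Γ(↑W, ⊤)}
    (h₂ : ∀ c : Γ(X.left, V₀ ⊓ V₁), Λ (1 ⊗ₜ c) = (W.ι ≫ p₀).appLE (V₀ ⊓ V₁) ⊤ hW c)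
    (ψ : R ⊗[k] Γ(X.left, V₀ ⊓ V₁) ≃ₐ[R] R ⊗[k] Γ(X.left, V₀ ⊓ V₁)) (hψ : ∀ x, IsNilpotent (ψ x - x))
    {Φ₁ : R ⊗[k] Γ(X.left, V₁) →ₐ[R] R ⊗[k] Γ(X.left, V₀ ⊓ V₁)}
    (hΦ₁ : ∀ a s, Φ₁ (a ⊗ₜ s) = a ⊗ₜ X.left.presheaf.map (homOfLE inf_le_right).op s) (x : W) :
    p₁ (((W : Scheme.{u}).toSpecΓ ≫ Spec.map (CommRingCat.ofHom
      (Λ.comp (ψ.symm.toAlgHom.toRingHom.comp Φ₁.toRingHom)))) x) = p₀ (W.ι x) := by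
  have h := chart_transition_base hV₀ hV₁ h01 p₀ hp₀ p₁ hp₁ hW h₂ ψ hψ hΦ₁
  rw [Scheme.Hom.comp_base, Scheme.Hom.comp_base] at h
  exact congrArg (fun f => f x) h

end Transition

/-! ## §G Sections of composites through an affine open; `r ⊗ 1` is fixed -/

section AppLENormalForm

/-- **Sections of a morphism in normal form through an affine open**:
`(Y.toSpecΓ ≫ Spec.map φ ≫ fromSpec_U)^*|_U = φ`. [cite: Hartshorne1977, II Prop. 2.3 / Ex. 2.4 (morphisms to `Spec`)] -/
theorem appLE_toSpecΓ_SpecMap_fromSpec {Z Y : Scheme.{u}} {U : Z.Opens} (hU : IsAffineOpen U)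
    (φ : Γ(Z, U) ⟶ Γ(Y, ⊤)) (h : ⊤ ≤ (Y.toSpecΓ ≫ Spec.map φ ≫ hU.fromSpec) ⁻¹ᵁ U) :
    (Y.toSpecΓ ≫ Spec.map φ ≫ hU.fromSpec).appLE U ⊤ h = φ := by
  have h' : ⊤ ≤ hU.fromSpec ⁻¹ᵁ U := by rw [hU.fromSpec_preimage_self]
  have e : (Y.toSpecΓ ≫ Spec.map φ ≫ hU.fromSpec).appLE U ⊤ h =
      hU.fromSpec.appLE U ⊤ h' ≫ (Y.toSpecΓ ≫ Spec.map φ).appTop := by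
    rw [Scheme.Hom.appTop, Scheme.Hom.app_eq_appLE, Scheme.Hom.appLE_comp_appLE,
      appLE_eq_of_eq (Category.assoc Y.toSpecΓ (Spec.map φ) hU.fromSpec)]
    rfl
  rw [e, appTop_toSpecΓ_SpecMap, Scheme.Hom.appLE, hU.fromSpec_app_self]
  simp only [Category.assoc]
  rw [← Functor.map_comp_assoc]
  have e2 : (eqToHom hU.fromSpec_preimage_self).op ≫ (homOfLE h').op = 𝟙 (op ⊤) := Subsingleton.elim _ _
  rw [e2, CategoryTheory.Functor.map_id, Category.id_comp, Iso.inv_hom_id_assoc]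

end AppLENormalForm

section Self

variable {k : Type u} [Field k] {X : Over (Spec (CommRingCat.of k))}
  [instΓ : ∀ W : X.left.Opens, Algebra k Γ(X.left, W)]
  (halg : ∀ (W : X.left.Opens) (s : k), algebraMap k Γ(X.left, W) s = (constToPresheaf X).app (op W) s)
  {R : Type u} [CommRing R] [Algebra k R]

omit instΓ in
/-- An `R`-algebra automorphism of `R ⊗_k B` fixes `r ⊗ 1`. [cite: AtiyahMacdonald1969, Ch. 2 (tensor product of algebras, pp. 30–31)] -/
theorem algEquiv_tmul_one {B : Type u} [CommRing B] [Algebra k B] (u : R ⊗[k] B ≃ₐ[R] R ⊗[k] B) (r : R) :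
    u (r ⊗ₜ 1) = r ⊗ₜ 1 := by
  have e : (r ⊗ₜ[k] (1 : B) : R ⊗[k] B) = algebraMap R (R ⊗[k] B) r := by
    rw [Algebra.TensorProduct.algebraMap_apply, Algebra.algebraMap_self, RingHom.id_apply]
  rw [e, AlgEquiv.commutes]

omit instΓ in
/-- A characterised base-change map fixes `r ⊗ 1`. [cite: Hartshorne2010, Thm. 10.2 (proof), p. 81] -/
theorem baseChangeMap_tmul_one [∀ W : X.left.Opens, Algebra k Γ(X.left, W)] {V W : X.left.Opens} (h : W ≤ V)
    {Φ : R ⊗[k] Γ(X.left, V) →ₐ[R] R ⊗[k] Γ(X.left, W)}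
    (hΦ : ∀ a s, Φ (a ⊗ₜ s) = a ⊗ₜ X.left.presheaf.map (homOfLE h).op s) (r : R) :
    Φ (r ⊗ₜ 1) = r ⊗ₜ 1 := by
  rw [hΦ, map_one]

variable {V₀ : X.left.Opens} (hV₀ : IsAffineOpen V₀)
  (p₀ : Spec (CommRingCat.of (R ⊗[k] Γ(X.left, V₀))) ⟶ X.left)
  (hp₀ : p₀ = Spec.map (CommRingCat.ofHom
    (Algebra.TensorProduct.includeRight (R := k) (A := R) (B := Γ(X.left, V₀))).toRingHom) ≫ hV₀.fromSpec)

/-! ## §H The self-transition; base change along equal opens -/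


include hp₀ in
/-- **The self-transition is the inclusion**: for `ψ = 1` (which the cocycle condition forces on `U j ∩ U j`, see
`apply_eq_self_of_cocycle_self`), `W.toSpecΓ ≫ Spec (Λ ∘ ψ⁻¹ ∘ Φ) = W ↪ Spec (R ⊗_k Γ(V₀))` (the `t_self` axiom of ★
`OpensGlueDatum`). [cite: StacksProject, Tag 01JA] [cite: Hartshorne2010, Thm. 10.2 (proof), p. 81] -/
theorem transition_self {W : (Spec (CommRingCat.of (R ⊗[k] Γ(X.left, V₀)))).Opens}
    (hW : ⊤ ≤ (W.ι ≫ p₀) ⁻¹ᵁ (V₀ ⊓ V₀)) {Λ : R ⊗[k] Γ(X.left, V₀ ⊓ V₀) →+* Γ(↑W, ⊤)}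
    (h₁ : ∀ r : R, Λ (r ⊗ₜ 1) =
      W.ι.appTop ((Scheme.ΓSpecIso (CommRingCat.of (R ⊗[k] Γ(X.left, V₀)))).inv (r ⊗ₜ 1)))
    (h₂ : ∀ c : Γ(X.left, V₀ ⊓ V₀), Λ (1 ⊗ₜ c) = (W.ι ≫ p₀).appLE (V₀ ⊓ V₀) ⊤ hW c)
    (ψ : R ⊗[k] Γ(X.left, V₀ ⊓ V₀) ≃ₐ[R] R ⊗[k] Γ(X.left, V₀ ⊓ V₀)) (hψ : ∀ x, ψ x = x)
    {Φ : R ⊗[k] Γ(X.left, V₀) →ₐ[R] R ⊗[k] Γ(X.left, V₀ ⊓ V₀)}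
    (hΦ : ∀ a s, Φ (a ⊗ₜ s) = a ⊗ₜ X.left.presheaf.map (homOfLE inf_le_right).op s) :
    (W : Scheme.{u}).toSpecΓ ≫ Spec.map (CommRingCat.ofHom (Λ.comp (ψ.symm.toAlgHom.toRingHom.comp Φ.toRingHom))) =
      W.ι := by
  have hψ' : ∀ y, ψ.symm.toAlgHom.toRingHom y = y := fun y => by
    have h := hψ (ψ.symm y)
    rw [AlgEquiv.apply_symm_apply] at h
    exact h.symm
  conv_rhs => rw [eq_toSpecΓ_SpecMap W.ι]
  apply toSpecΓ_SpecMap_congr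
  apply CommRingCat.hom_ext
  rw [CommRingCat.hom_ofHom, CommRingCat.hom_comp]
  refine ringHom_ext_tmul (fun r => ?_) (fun c => ?_)
  · calc (Λ.comp (ψ.symm.toAlgHom.toRingHom.comp Φ.toRingHom)) (r ⊗ₜ 1)
        = Λ (ψ.symm.toAlgHom.toRingHom (Φ (r ⊗ₜ 1))) :=
          (RingHom.comp_apply _ _ _).trans (congrArg (fun y => Λ y) (RingHom.comp_apply _ _ _))
      _ = Λ (r ⊗ₜ 1) := congrArg (fun y => Λ y)
          ((congrArg (fun y => ψ.symm.toAlgHom.toRingHom y) (baseChangeMap_tmul_one inf_le_right hΦ r)).trans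
            (hψ' _))
      _ = W.ι.appTop ((Scheme.ΓSpecIso (CommRingCat.of (R ⊗[k] Γ(X.left, V₀)))).inv (r ⊗ₜ 1)) := h₁ r
      _ = (W.ι.appTop.hom.comp (Scheme.ΓSpecIso (CommRingCat.of (R ⊗[k] Γ(X.left, V₀)))).inv.hom) (r ⊗ₜ 1) :=
          (RingHom.comp_apply _ _ _).symm
  · calc (Λ.comp (ψ.symm.toAlgHom.toRingHom.comp Φ.toRingHom)) (1 ⊗ₜ c)
        = Λ (ψ.symm.toAlgHom.toRingHom (Φ (1 ⊗ₜ c))) :=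
          (RingHom.comp_apply _ _ _).trans (congrArg (fun y => Λ y) (RingHom.comp_apply _ _ _))
      _ = Λ (Φ (1 ⊗ₜ c)) := congrArg (fun y => Λ y) (hψ' _)
      _ = Λ (1 ⊗ₜ X.left.presheaf.map (homOfLE inf_le_right).op c) := congrArg (fun y => Λ y) (hΦ 1 c)
      _ = W.ι.appTop ((Scheme.ΓSpecIso (CommRingCat.of (R ⊗[k] Γ(X.left, V₀)))).inv (1 ⊗ₜ c)) :=
          chartRingHom_one_tmul_map hV₀ p₀ hp₀ inf_le_right h₂ c
      _ = (W.ι.appTop.hom.comp (Scheme.ΓSpecIso (CommRingCat.of (R ⊗[k] Γ(X.left, V₀)))).inv.hom) (1 ⊗ₜ c) :=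
          (RingHom.comp_apply _ _ _).symm

omit instΓ in
/-- Base-change maps along EQUAL opens are injective (they have a left inverse, the base change the other way).
[cite: Hartshorne2010, Thm. 10.2 (proof), p. 81] [cite: AtiyahMacdonald1969, Ch. 2 (tensor product of algebras, pp. 30–31)] -/
theorem baseChangeMap_injective_of_le_of_le [∀ W : X.left.Opens, Algebra k Γ(X.left, W)] {V W : X.left.Opens}
    (h : W ≤ V) (h' : V ≤ W)
    {Φ : R ⊗[k] Γ(X.left, V) →ₐ[R] R ⊗[k] Γ(X.left, W)}
    (hΦ : ∀ a s, Φ (a ⊗ₜ s) = a ⊗ₜ X.left.presheaf.map (homOfLE h).op s)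
    {Φ' : R ⊗[k] Γ(X.left, W) →ₐ[R] R ⊗[k] Γ(X.left, V)}
    (hΦ' : ∀ a s, Φ' (a ⊗ₜ s) = a ⊗ₜ X.left.presheaf.map (homOfLE h').op s) : Function.Injective Φ := by
  have hid : ∀ x, Φ' (Φ x) = x := by
    intro x
    have key : Φ'.comp Φ = AlgHom.id R _ := Algebra.TensorProduct.ext' fun a s => by
      rw [AlgHom.comp_apply, hΦ, hΦ', AlgHom.id_apply, ← CommRingCat.comp_apply, ← X.left.presheaf.map_comp]
      have e : (homOfLE h).op ≫ (homOfLE h').op = 𝟙 (op V) := Subsingleton.elim _ _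
      rw [e, CategoryTheory.Functor.map_id, CommRingCat.id_apply]
    exact AlgHom.congr_fun key x
  exact Function.LeftInverse.injective hid

/-- **The transition maps are morphisms over `Spec R`**: `t ≫ (Spec (R ⊗_k Γ(V₁)) → Spec R) = (W ↪ Spec (R ⊗_k Γ(V₀))) ≫
(Spec (R ⊗_k Γ(V₀)) → Spec R)` (`ψ` is `R`-linear and `Λ (r ⊗ 1) = r|_W`) — the compatibility asked by ★
`Morphisms/GlueDataOverBase.glueData_existsUnique_desc` to descend the structure maps to the glued scheme.
[cite: StacksProject, Tag 01JA] [cite: Hartshorne2010, Thm. 10.2 (proof), p. 81] -/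
theorem transition_over_base {V₁ : X.left.Opens} {W : (Spec (CommRingCat.of (R ⊗[k] Γ(X.left, V₀)))).Opens}
    {Λ : R ⊗[k] Γ(X.left, V₀ ⊓ V₁) →+* Γ(↑W, ⊤)}
    (h₁ : ∀ r : R, Λ (r ⊗ₜ 1) =
      W.ι.appTop ((Scheme.ΓSpecIso (CommRingCat.of (R ⊗[k] Γ(X.left, V₀)))).inv (r ⊗ₜ 1)))
    (ψ : R ⊗[k] Γ(X.left, V₀ ⊓ V₁) ≃ₐ[R] R ⊗[k] Γ(X.left, V₀ ⊓ V₁))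
    {Φ : R ⊗[k] Γ(X.left, V₁) →ₐ[R] R ⊗[k] Γ(X.left, V₀ ⊓ V₁)}
    (hΦ : ∀ a s, Φ (a ⊗ₜ s) = a ⊗ₜ X.left.presheaf.map (homOfLE inf_le_right).op s) :
    ((W : Scheme.{u}).toSpecΓ ≫ Spec.map (CommRingCat.ofHom (Λ.comp (ψ.symm.toAlgHom.toRingHom.comp Φ.toRingHom)))) ≫
        Spec.map (CommRingCat.ofHom (Algebra.TensorProduct.includeLeftRingHom (R := k) (A := R) (B := Γ(X.left, V₁)))) =
      W.ι ≫ Spec.map (CommRingCat.ofHom (Algebra.TensorProduct.includeLeftRingHom (R := k) (A := R) (B := Γ(X.left, V₀)))) := by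
  conv_rhs => rw [eq_toSpecΓ_SpecMap W.ι]
  rw [Category.assoc, ← Spec.map_comp, Category.assoc, ← Spec.map_comp]
  apply toSpecΓ_SpecMap_congr
  apply CommRingCat.hom_ext
  refine RingHom.ext fun r => ?_
  calc (Λ.comp (ψ.symm.toAlgHom.toRingHom.comp Φ.toRingHom))
        (Algebra.TensorProduct.includeLeftRingHom (R := k) (A := R) (B := Γ(X.left, V₁)) r)
      = Λ (ψ.symm.toAlgHom.toRingHom (Φ (r ⊗ₜ 1))) :=
        (RingHom.comp_apply _ _ _).trans (congrArg (fun y => Λ y) (RingHom.comp_apply _ _ _))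
    _ = Λ (r ⊗ₜ 1) := congrArg (fun y => Λ y)
        ((congrArg (fun y => ψ.symm.toAlgHom.toRingHom y) (baseChangeMap_tmul_one inf_le_right hΦ r)).trans
          (algEquiv_tmul_one ψ.symm r))
    _ = W.ι.appTop ((Scheme.ΓSpecIso (CommRingCat.of (R ⊗[k] Γ(X.left, V₀)))).inv (r ⊗ₜ 1)) := h₁ r
    _ = (W.ι.appTop.hom.comp (Scheme.ΓSpecIso (CommRingCat.of (R ⊗[k] Γ(X.left, V₀)))).inv.hom)
        (Algebra.TensorProduct.includeLeftRingHom (R := k) (A := R) (B := Γ(X.left, V₀)) r) :=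
        (RingHom.comp_apply _ _ _).symm

end Self

end Literature.AlgebraicGeometry.Deformation

end
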